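import Summits.Schanuel.Schanuel.Theorems.SoloInformedBoxDimension

/-!
# Proposition BD (ii) — the floor `dim Box_d ≥ 2d + 1` and the box dimensions at `(e, π)`

Solo programme `solo-Schanuel-informed` (verdict NO PATH unchanged; companion of
`SoloInformedBoxDimension`, whose cap it complements).  `Box_d(x)`, `dim Box_d(x)` as there.

## Statements (all sorry-free)

* §3 FLOOR `two_mul_add_one_le_finrank_span_box` — for `x ∈ ℝ²` with BOTH coordinates
  transcendental, `2d + 1 ≤ dim Box_d(x)`: the layers `U_j = ⟨x₀ⁱx₁ᵏ : i ≤ j, k ≤ d⟩`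
  (`layerSpan`) have `dim U_0 ≥ d + 1` (powers of `x₁`, `succ_le_finrank_layerSpan`) and
  strictly increase (`finrank_layerSpan_lt_succ`: a stalled layer is a finite-dimensional
  `ℚ`-space stable under multiplication by `x₀` and containing `1`, hence containing every power
  of the transcendental `x₀` — absurd).
* §5 AT `(e, π)` — `finrank_span_box_expOnePi_bounds` (`2d+1 ≤ dim Box_d(e,π) ≤ (d+1)²`,
  unconditional: `e` and `π` are each transcendental, tree facts `transcendental_exp_one_holds`,
  `transcendental_pi_holds`), `finrank_span_box_eq_of_not_bilinearFloor` (`¬ BilinearFloor ⟹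
  dim Box_d(e,π) = 2d+1` for every `d ≥ 1`, by the cap of the companion file at bidegree
  `(1,1)`), `bilinearFloor_iff_exists_box_finrank` (**`BilinearFloor ⟺ ∃ d ≥ 1,
  dim Box_d(e,π) ≥ 2d + 2`**).

## Reading

The unconditional count in a box is `2d + 1`; a bilinear relation `a + b·e + c·π + d·eπ = 0`
would make it exact in every box, and the bilinear floor (the first open rung below `e ⟂ π` in
this programme) is equivalent to exceeding the count by ONE in some — equivalently every — box
`Box_d(e,π)`, `d ≥ 1`.  With the companion's door this reads: Nesterenko data of exponent
`τ_d > 2d` on one box would do; none is known.  Numbers: the box `d = 2` has `9` monomials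
`eⁱπʲ (i, j ≤ 2)`, unconditional dimension `≥ 5`, and `6` independent ones among them would give
`BilinearFloor`; `d = 3`: `16` monomials, `≥ 7` unconditionally, `8` would do.

## References

* [BakerTNT1975] A. Baker, *Transcendental Number Theory*, Cambridge Univ. Press 1975, Ch. 1,
  Theorems 1.2–1.3 (transcendence of `e` and of `π`), as cited by the tree files discharging
  `transcendental_exp_one` and `transcendental_pi`.
* [Nesterenko1985] Yu. V. Nesterenko, *On the linear independence of numbers*, Moscow Univ.
  Math. Bull. 40 (1985), 69–74 — the criterion behind the doors of the companion file.
-/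

noncomputable section

open Filter Topology Finset
open Literature.NumberTheory.Transcendental (ExpOnePiAlgebraicIndependent transcendental_exp_one
  transcendental_pi transcendental_exp_one_holds transcendental_pi_holds)

namespace Summit.Schanuel.Schanuel.Theorems

/-! ### §3 The floor: both coordinates transcendental give `dim Box_d ≥ 2d + 1` -/

section Floor

/-- The powers `1, t, …, t^{m−1}` of a transcendental element are linearly independent.
[folklore; re-proved here under a local name] -/
theorem transcendental_linearIndependent_fin_pow {K R : Type*} [CommRing K] [Ring R] [Algebra K R]
    {t : R} (ht : Transcendental K t) (m : ℕ) :
    LinearIndependent K fun l : Fin m => t ^ (l : ℕ) := by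
  classical
  rw [Fintype.linearIndependent_iff]
  intro g hg l
  have hinj := transcendental_iff_injective.mp ht
  set p : Polynomial K := ∑ j : Fin m, Polynomial.monomial (j : ℕ) (g j) with hp
  have hp0 : p = 0 := hinj (by
    rw [map_zero, hp, map_sum]
    simp only [Polynomial.aeval_monomial, ← Algebra.smul_def]
    exact hg)
  have hcoeff : p.coeff (l : ℕ) = g l := by
    rw [hp, Polynomial.finsetSum_coeff]
    simp only [Polynomial.coeff_monomial]
    rw [Finset.sum_eq_single l (fun j _ hj => if_neg fun h => hj (Fin.ext h)) (by simp)]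
    simp
  rw [← hcoeff, hp0, Polynomial.coeff_zero]

/-- Layer `j` of the box in two variables: the monomials `x₀ⁱ x₁ᵏ`, `i ≤ j`, `k ≤ d`. -/
def layerMonomial (x : Fin 2 → ℝ) (d j : ℕ) (p : Fin (j + 1) × Fin (d + 1)) : ℝ :=
  x 0 ^ (p.1 : ℕ) * x 1 ^ (p.2 : ℕ)

/-- The `ℚ`-span `U_j` of layer `j`. -/
def layerSpan (x : Fin 2 → ℝ) (d j : ℕ) : Submodule ℚ ℝ :=
  Submodule.span ℚ (Set.range (layerMonomial x d j))

/-- Each layer is finite-dimensional over `ℚ`. -/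
instance layerSpan.moduleFinite (x : Fin 2 → ℝ) (d j : ℕ) : Module.Finite ℚ (layerSpan x d j) :=
  Module.Finite.span_of_finite ℚ (Set.finite_range _)

/-- The layers increase. -/
theorem layerSpan_le_succ (x : Fin 2 → ℝ) (d j : ℕ) : layerSpan x d j ≤ layerSpan x d (j + 1) := by
  refine Submodule.span_mono (Set.range_subset_iff.mpr fun p => ⟨(Fin.castSucc p.1, p.2), ?_⟩)
  simp [layerMonomial]

/-- Multiplication by `x₀` maps layer `j` into layer `j + 1`. -/
theorem map_mulLeft_layerSpan_le (x : Fin 2 → ℝ) (d j : ℕ) :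
    (layerSpan x d j).map (LinearMap.mulLeft ℚ (x 0)) ≤ layerSpan x d (j + 1) := by
  rw [layerSpan, Submodule.map_span_le]
  rintro m ⟨p, rfl⟩
  refine Submodule.subset_span ⟨(Fin.succ p.1, p.2), ?_⟩
  simp [layerMonomial, pow_succ]
  ring

/-- The powers `x₁ᵏ`, `k ≤ d`, lie in every layer; so `dim U_j ≥ d + 1` when `x₁` is
transcendental. -/
theorem succ_le_finrank_layerSpan {x : Fin 2 → ℝ} (h1 : Transcendental ℚ (x 1)) (d j : ℕ) :
    d + 1 ≤ Module.finrank ℚ (layerSpan x d j) := by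
  have hle : Submodule.span ℚ (Set.range fun k : Fin (d + 1) => x 1 ^ (k : ℕ)) ≤ layerSpan x d j := by
    refine Submodule.span_mono (Set.range_subset_iff.mpr fun k => ⟨((0 : Fin (j + 1)), k), ?_⟩)
    simp [layerMonomial]
  have := Submodule.finrank_mono hle
  rwa [finrank_span_eq_card (transcendental_linearIndependent_fin_pow h1 (d + 1)),
    Fintype.card_fin] at this

/-- **The layers strictly increase** when `x₀` is transcendental: a stalled layer would be a
finite-dimensional `ℚ`-space containing `1` and stable under multiplication by `x₀`. -/
theorem finrank_layerSpan_lt_succ {x : Fin 2 → ℝ} (h0 : Transcendental ℚ (x 0)) (d j : ℕ) :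
    Module.finrank ℚ (layerSpan x d j) < Module.finrank ℚ (layerSpan x d (j + 1)) := by
  by_contra hlt
  push Not at hlt
  have hle := layerSpan_le_succ x d j
  have heq : layerSpan x d j = layerSpan x d (j + 1) :=
    Submodule.eq_of_le_of_finrank_eq hle (le_antisymm (Submodule.finrank_mono hle) hlt)
  have hst : (layerSpan x d j).map (LinearMap.mulLeft ℚ (x 0)) ≤ layerSpan x d j := by
    have := map_mulLeft_layerSpan_le x d j
    rwa [← heq] at this
  have hpow : ∀ m : ℕ, x 0 ^ m ∈ layerSpan x d j := by
    intro m
    induction m with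
    | zero =>
      exact Submodule.subset_span ⟨((0 : Fin (j + 1)), (0 : Fin (d + 1))), by simp [layerMonomial]⟩
    | succ m ih =>
      have := hst (Submodule.mem_map_of_mem ih)
      simpa [pow_succ'] using this
  set N := Module.finrank ℚ (layerSpan x d j) with hN
  have hspan : Submodule.span ℚ (Set.range fun m : Fin (N + 1) => x 0 ^ (m : ℕ)) ≤
      layerSpan x d j :=
    Submodule.span_le.mpr (Set.range_subset_iff.mpr fun m => hpow m)
  have h1 := Submodule.finrank_mono hspan
  rw [finrank_span_eq_card (transcendental_linearIndependent_fin_pow h0 (N + 1)),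
    Fintype.card_fin] at h1
  omega

/-- `dim U_j ≥ d + 1 + j`. -/
theorem add_le_finrank_layerSpan {x : Fin 2 → ℝ} (h0 : Transcendental ℚ (x 0))
    (h1 : Transcendental ℚ (x 1)) (d : ℕ) :
    ∀ j : ℕ, d + 1 + j ≤ Module.finrank ℚ (layerSpan x d j)
  | 0 => succ_le_finrank_layerSpan h1 d 0
  | j + 1 => by
    have := add_le_finrank_layerSpan h0 h1 d j
    have := finrank_layerSpan_lt_succ h0 d j
    omega

/-- The top layer lies in (indeed is) the span of the box. -/
theorem layerSpan_le_span_box (x : Fin 2 → ℝ) (d : ℕ) :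
    layerSpan x d d ≤ Submodule.span ℚ (Set.range (boxMonomial x d)) := by
  refine Submodule.span_mono (Set.range_subset_iff.mpr fun p => ⟨![p.1, p.2], ?_⟩)
  simp [layerMonomial, boxMonomial, Fin.prod_univ_two]

/-- **Proposition BD, the floor.**  If both coordinates of `x ∈ ℝ²` are transcendental then
`dim_ℚ ⟨Box_d(x)⟩ ≥ 2d + 1`. -/
theorem two_mul_add_one_le_finrank_span_box {x : Fin 2 → ℝ} (h0 : Transcendental ℚ (x 0))
    (h1 : Transcendental ℚ (x 1)) (d : ℕ) :
    2 * d + 1 ≤ Module.finrank ℚ (Submodule.span ℚ (Set.range (boxMonomial x d))) := by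
  haveI : Module.Finite ℚ (Submodule.span ℚ (Set.range (boxMonomial x d))) :=
    Module.Finite.span_of_finite ℚ (Set.finite_range _)
  have h := add_le_finrank_layerSpan h0 h1 d d
  have h' := Submodule.finrank_mono (layerSpan_le_span_box x d)
  omega

end Floor

/-! ### §5 The box dimensions at `(e, π)` -/

section ExpPi

/-- **Unconditionally `2d + 1 ≤ dim_ℚ ⟨Box_d(e, π)⟩ ≤ (d + 1)²`** (`e` and `π` are each
transcendental). -/
theorem finrank_span_box_expOnePi_bounds (d : ℕ) :
    2 * d + 1 ≤ Module.finrank ℚ (Submodule.span ℚ (Set.range (boxMonomial ![Real.exp 1, Real.pi] d))) ∧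
      Module.finrank ℚ (Submodule.span ℚ (Set.range (boxMonomial ![Real.exp 1, Real.pi] d))) ≤
        (d + 1) ^ 2 := by
  classical
  have he : Transcendental ℚ (Real.exp 1) := transcendental_exp_one_holds
  have hpi : Transcendental ℚ Real.pi := transcendental_pi_holds
  refine ⟨two_mul_add_one_le_finrank_span_box (x := ![Real.exp 1, Real.pi])
    (by simpa using he) (by simpa using hpi) d, ?_⟩
  calc Module.finrank ℚ (Submodule.span ℚ (Set.range (boxMonomial ![Real.exp 1, Real.pi] d)))
      ≤ Fintype.card (Fin 2 → Fin (d + 1)) := finrank_range_le_card _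
    _ = (d + 1) ^ 2 := by simp

/-- **If the bilinear floor fails, every box has exactly the floor dimension `2d + 1`.** -/
theorem finrank_span_box_eq_of_not_bilinearFloor (hB : ¬ BilinearFloor) {d : ℕ} (hd : 1 ≤ d) :
    Module.finrank ℚ (Submodule.span ℚ (Set.range (boxMonomial ![Real.exp 1, Real.pi] d))) =
      2 * d + 1 := by
  classical
  rw [bilinearFloor_iff_box_one, box_linearIndependent_iff_forall_eq_zero] at hB
  push Not at hB
  obtain ⟨F, hF1, hFx, hF0⟩ := hB
  have had : ∀ i : Fin 2, (![1, 1] : Fin 2 → ℕ) i ≤ d := fun i => by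
    fin_cases i <;> simpa using hd
  have hFa : ∀ i : Fin 2, F.degreeOf i ≤ (![1, 1] : Fin 2 → ℕ) i := fun i => by
    fin_cases i <;> simpa using hF1 _
  have hcap := finrank_span_box_add_le_of_relation (x := ![Real.exp 1, Real.pi]) had hF0 hFa hFx
  have hprod : ∏ i : Fin 2, (d + 1 - (![1, 1] : Fin 2 → ℕ) i) = d * d := by
    rw [Fin.prod_univ_two]
    simp
  rw [hprod] at hcap
  have hfloor := (finrank_span_box_expOnePi_bounds d).1
  have hsq : (d + 1) ^ 2 = d * d + (2 * d + 1) := by ring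
  rw [hsq] at hcap
  omega

/-- **The bilinear floor, reformulated as a box count.**  `BilinearFloor` holds iff SOME box
`Box_d(e, π)`, `d ≥ 1`, spans a `ℚ`-space of dimension at least `2d + 2` — one more than the
unconditional count `2d + 1`. -/
theorem bilinearFloor_iff_exists_box_finrank :
    BilinearFloor ↔ ∃ d : ℕ, 1 ≤ d ∧
      2 * d + 2 ≤ Module.finrank ℚ (Submodule.span ℚ (Set.range (boxMonomial ![Real.exp 1, Real.pi] d))) := by
  classical
  constructor
  · intro hB
    refine ⟨1, le_rfl, ?_⟩
    rw [finrank_span_eq_card (bilinearFloor_iff_box_one.mp hB)]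
    simp
  · rintro ⟨d, hd, h⟩
    by_contra hB
    have := finrank_span_box_eq_of_not_bilinearFloor hB hd
    omega

end ExpPi

end Summit.Schanuel.Schanuel.Theorems

end
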